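import Summits.NavierStokesRegularity.TurbBounds.ShearSpecPieces
import Literature.Analysis.SpecialFunctions.LegendreTripleProduct
import HarnessLib

/-!
# rbsdp SPEC 1.1's closed form `triple l m n` IS the integral of three Legendre polynomials — via the tree's Literature Gaunt integral
(cell `pub-turb` / `turb-bounds`, shear lane; v2 staging, written by pub-turb-shear gen 7, 2026-08-22.)

HONEST FRAMING: rigorous bounds for the stated PDE and boundary conditions; no claim about physical turbulence beyond the bound.
The generator-C table `ShearSpecPieces.triple l m n` (the Adams–Neumann closed form of rbsdp SPEC 1.1, a computable rational used in `kTab`/`eTab`)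
equals `2·(l m n; 0 0 0)²` = `Literature.Analysis.SpecialFunctions.threeJZeroSq` (`triple_cast_eq_two_mul_threeJZeroSq`, case by case on parity and
triangle conditions against `threeJZeroSq_eq_factorial` [cite: DLMF, 34.3.5]), hence equals `∫_{−1}^{1} P_l P_m P_n`
(`triple_cast_eq_integral`, by `integral_legendre_mul_legendre_mul_legendre` [cite: DLMF, 34.3.21]) for ALL indices. This replaces, for the purposes
of the bridge, the box-limited recursion route (`ShearTripleRec/Rec2/Link`, `tripleCoeff`): the identification of the literal cross-term pieces with
the integrals `∫ φ′ P_n P_m` needs nothing else.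
-/

set_option linter.style.longLine false

noncomputable section

namespace Summit.NavierStokesRegularity.TurbBounds.ShearTripleGaunt

open Polynomial intervalIntegral Literature.Analysis.SpecialFunctions
open Summit.NavierStokesRegularity.TurbBounds.ShearSpecPieces (triple)

/-- **`triple l m n = 2·(l m n; 0 0 0)²`** (the SPEC 1.1 closed form is the squared `3j`-symbol form of the Gaunt integral). -/
theorem triple_cast_eq_two_mul_threeJZeroSq (l m n : ℕ) : ((triple l m n : ℚ) : ℝ) = 2 * threeJZeroSq l m n := by
  by_cases h1 : (l + m + n) % 2 = 1
  · rw [threeJZeroSq_eq_zero_of_mod_two h1]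
    simp [triple, h1]
  · by_cases h2 : m + n < l ∨ l + n < m ∨ l + m < n
    · have hz : threeJZeroSq l m n = 0 := by
        rcases h2 with h | h | h
        · exact threeJZeroSq_eq_zero_of_lt₂ h
        · exact threeJZeroSq_eq_zero_of_lt₃ (by omega)
        · exact threeJZeroSq_eq_zero_of_lt₁ h
      rw [hz]
      simp [triple, h1, h2]
    · have he : Even (l + m + n) := by rw [Nat.even_iff]; omega
      obtain ⟨s, hs⟩ := he
      rw [threeJZeroSq_eq_factorial ⟨s, hs⟩ (by omega) (by omega) (by omega)]
      simp only [triple, if_neg h1, if_neg h2]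
      have hs2 : (l + m + n) / 2 = s := by omega
      rw [hs2, show l + m + n - 2 * l = 2 * s - 2 * l by omega, show l + m + n - 2 * m = 2 * s - 2 * m by omega,
        show l + m + n - 2 * n = 2 * s - 2 * n by omega, show l + m + n + 1 = 2 * s + 1 by omega]
      push_cast
      ring

/-- **`triple l m n = ∫_{−1}^{1} P_l P_m P_n`** for all `l, m, n`. -/
theorem triple_cast_eq_integral (l m n : ℕ) :
    ((triple l m n : ℚ) : ℝ) = ∫ x in (-1 : ℝ)..1, (legendre l).eval x * (legendre m).eval x * (legendre n).eval x := by
  rw [triple_cast_eq_two_mul_threeJZeroSq, integral_legendre_mul_legendre_mul_legendre]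

/-- The same with the integrand in the order `P_n P_m P_l` (the order in which `ShearCoupling.lam3_expansion` produces it for `kTab`'s `triple m' n p`). -/
theorem triple_cast_eq_integral' (l m n : ℕ) :
    ((triple l m n : ℚ) : ℝ) = ∫ x in (-1 : ℝ)..1, (legendre n).eval x * (legendre m).eval x * (legendre l).eval x := by
  rw [triple_cast_eq_integral]
  exact intervalIntegral.integral_congr fun x _ => by ring

end Summit.NavierStokesRegularity.TurbBounds.ShearTripleGaunt

end
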